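import Summits.QuantumFields.YangMills.Theorems.BalabanLadderUVSeamRecGaussianCalibrationCubes
import Summits.QuantumFields.YangMills.Theorems.BalabanLadderUVSeamRecGaussianCalibrationMoments
import Summits.QuantumFields.YangMills.Theorems.WeakCouplingRatesHarmonicInteriorGradient
import Literature.Probability.LatticeModels.LatticeGreenPotential
import HarnessLib

/-!
# Crux `UVSeamRec` (stmt-QuantumFields-20043), free-field calibration of (RM), file 5: SHARPNESS — the `R⁻⁴` law of the free-field response
# is two-sided

Helper file (`--supports stmt-QuantumFields-20043`) of the seam seat `ym-20043-seam-s2` (gen 3); theorems only, no definitions.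

WHY.  The free-field calibration (`…GaussianCalibrationLaw.gff_responseMoments`) proves the registered stub's (RM) currency — joint exponential
response moments at weight `R⁴/C₁` — for the lattice GFF `ν` of `ℤ⁴`, and `gff_integral_centreGradient_sq_le` gives the upper `R⁻⁴` law
`∫(∇_j h(x))² dν ≤ v/R⁴` for the harmonic extension `h = φ − ψ^Λ` of the exterior field into the cube `Λ = x + sbox(R+1)`.  THIS FILE proves the
matching LOWER bound `∫(∇_j h(x))² dν ≥ c/R⁴` for all large `R` (`gff_integral_centreGradient_sq_ge`): in the free field the response of the
centre "plaquette" to the exterior is EXACTLY of order `R⁻⁴`, so the weight `R⁴` of (RM) is critical — no currency with a faster rate (weight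
`w(R)·R⁴`, `w → ∞`, in particular rate-`R⁻⁴` RARITY with small constant) is Gaussian-consistent (the theorem behind ceilings-p2 #54 / tempered-d1
OBJECTION-top-scale).  Proof: Cauchy–Schwarz against the exterior statistic `Y = Σ_{z ∈ cap} φ_{x+z}`, `cap = {z : |z_k| ≤ 2N, N ≤ z_j}`, `N = R+2`:
`Cov(∇_jh(x), Y) = Cov(∇_jφ(x), Y) = ½Σ_{cap}(G(z−e_j) − G(z)) ≥ a₄N/8` by the tree's Lawler gradient asymptotics (`∇G = 2a₄ z_j/|z|⁴ + O(|z|⁻⁴)`),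
while `Var Y = ½ greenEnergy ≤ C N⁶` by the Green decay `G ≤ K/‖z‖²` summed over sup-norm shells.

No sorry, standard axioms.  HONEST FRAMING: lattice potential theory + Gaussian calculus for the massless free field; a TIGHTNESS lemma for the
calibration of one OPEN binder of a CONDITIONAL chain; nothing of E0′, not a gap, not Clay.
References: G. F. Lawler, *Intersections of Random Walks* (1991), Thm. 1.5.5; Friedli–Velenik 2017, Ch. 8.
-/

set_option autoImplicit false

noncomputable section

open MeasureTheory ProbabilityTheory Finset
open Literature.Probability.LatticeModels
open Literature.MathematicalPhysics.QuantumFieldTheory.LatticeForm (e)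
open Summit.QuantumFields.YangMills.Theorems.WeakCouplingRates
open Summit.QuantumFields.YangMills.Theorems.WeakCouplingRates.HarmonicInterior

namespace Summit.QuantumFields.YangMills.Cruxes.UVSeamRec.GaussianCalibration

/-! ## §1 Lattice sums of the Green kernel over sup-boxes -/

/-- Shell bound: `Σ_{u ∈ sbox M, u ≠ 0} ‖u‖⁻² ≤ 432·M²` on `ℤ⁴` (each sup-sphere of radius `k` has `≤ 16(2k+1)³` points). [folklore] -/
theorem sum_sbox_inv_norm_sq_le (M : ℕ) :
    ∑ u ∈ (sbox (d := 4) M).erase 0, 1 / ‖u‖ ^ 2 ≤ 432 * (M : ℝ) ^ 2 := by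
  classical
  -- cover `sbox M ∖ {0}` by the kink sets `A i k = {u ∈ sbox k : |u_i| = k}`, `1 ≤ k ≤ M`
  set A : Fin 4 → ℕ → Finset (Site 4) := fun i k => (sbox k).filter (fun u => |u i| = k ∨ |u i| = k) with hA
  have hcover : ∀ u ∈ (sbox (d := 4) M).erase 0, ∃ i : Fin 4, ∃ k ∈ Finset.Icc 1 M, u ∈ A i k ∧ ‖u‖ = k := by
    intro u hu
    rw [Finset.mem_erase] at hu
    obtain ⟨hu0, huM⟩ := hu
    -- the coordinate realising the sup norm
    obtain ⟨i, hi⟩ : ∃ i : Fin 4, ‖u‖ = |((u i : ℤ) : ℝ)| := by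
      obtain ⟨i, -, hi⟩ := Finset.exists_mem_eq_sup (Finset.univ : Finset (Fin 4)) Finset.univ_nonempty (fun k => ‖u k‖₊)
      refine ⟨i, ?_⟩
      rw [Pi.norm_def, hi, coe_nnnorm, Int.norm_eq_abs]
    have hk1 : (1 : ℤ) ≤ |u i| := by
      have h1 : (1 : ℝ) ≤ ‖u‖ := one_le_norm_of_ne_zero hu0
      rw [hi] at h1; exact_mod_cast h1
    have hkM : |u i| ≤ (M : ℤ) := mem_sbox.1 huM i
    refine ⟨i, (|u i|).toNat, Finset.mem_Icc.2 ⟨by omega, by omega⟩, ?_, ?_⟩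
    · simp only [hA, Finset.mem_filter, mem_sbox, or_self]
      refine ⟨fun k => ?_, by omega⟩
      have hk : |((u k : ℤ) : ℝ)| ≤ ‖u‖ := abs_coord_le_norm u k
      rw [hi] at hk
      have : |u k| ≤ |u i| := by exact_mod_cast hk
      omega
    · rw [hi]
      have : ((|u i|).toNat : ℤ) = |u i| := by omega
      rw [show (((|u i|).toNat : ℕ) : ℝ) = (((|u i|).toNat : ℤ) : ℝ) by norm_cast, this, Int.cast_abs]
  -- bound each term by the sum over its covering sets
  have hterm : ∀ u ∈ (sbox (d := 4) M).erase 0, 1 / ‖u‖ ^ 2 ≤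
      ∑ i : Fin 4, ∑ k ∈ Finset.Icc 1 M, if u ∈ A i k then 1 / (k : ℝ) ^ 2 else 0 := by
    intro u hu
    obtain ⟨i, k, hk, huA, hnorm⟩ := hcover u hu
    have hnonneg : ∀ i' k', 0 ≤ (if u ∈ A i' k' then 1 / (k' : ℝ) ^ 2 else 0) := fun i' k' => by
      split_ifs <;> positivity
    calc 1 / ‖u‖ ^ 2 = (if u ∈ A i k then 1 / (k : ℝ) ^ 2 else 0) := by rw [if_pos huA, hnorm]
      _ ≤ ∑ k' ∈ Finset.Icc 1 M, if u ∈ A i k' then 1 / (k' : ℝ) ^ 2 else 0 :=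
          Finset.single_le_sum (f := fun k' => if u ∈ A i k' then 1 / (k' : ℝ) ^ 2 else 0) (fun k' _ => hnonneg i k') hk
      _ ≤ ∑ i' : Fin 4, ∑ k' ∈ Finset.Icc 1 M, if u ∈ A i' k' then 1 / (k' : ℝ) ^ 2 else 0 :=
          Finset.single_le_sum (f := fun i' => ∑ k' ∈ Finset.Icc 1 M, if u ∈ A i' k' then 1 / (k' : ℝ) ^ 2 else 0)
            (fun i' _ => Finset.sum_nonneg fun k' _ => hnonneg i' k') (Finset.mem_univ i)
  refine (Finset.sum_le_sum hterm).trans ?_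
  rw [Finset.sum_comm]
  -- Σ_u Σ_i Σ_k [u ∈ A i k]/k² = Σ_i Σ_k #(A i k ∩ box)/k² ≤ Σ_i Σ_k 4(2k+1)³/k²
  have hcard : ∀ (i : Fin 4) (k : ℕ), 1 ≤ k →
      ∑ u ∈ (sbox (d := 4) M).erase 0, (if u ∈ A i k then 1 / (k : ℝ) ^ 2 else 0) ≤ 108 * (k : ℝ) := by
    intro i k hk
    rw [← Finset.sum_filter, Finset.sum_const, nsmul_eq_mul]
    have h1 : (#(((sbox (d := 4) M).erase 0).filter (fun u => u ∈ A i k)) : ℝ) ≤ #(A i k) := by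
      exact_mod_cast Finset.card_le_card fun u hu => (Finset.mem_filter.1 hu).2
    have h2 : (#(A i k) : ℝ) ≤ 4 * (2 * k + 1) ^ 3 := by
      have := card_filter_kink_le (d := 4) k i k k
      simp only [hA] at this ⊢
      exact_mod_cast this
    have hkpos : (0 : ℝ) < k := by exact_mod_cast hk
    have h3 : (4 : ℝ) * (2 * k + 1) ^ 3 ≤ 108 * (k : ℝ) ^ 3 := by
      have : (1 : ℝ) ≤ k := by exact_mod_cast hk
      nlinarith [pow_le_pow_left₀ (by positivity : (0:ℝ) ≤ 2 * k + 1) (by linarith : (2:ℝ) * k + 1 ≤ 3 * k) 3]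
    calc (#(((sbox (d := 4) M).erase 0).filter (fun u => u ∈ A i k)) : ℝ) * (1 / (k : ℝ) ^ 2)
        ≤ 108 * (k : ℝ) ^ 3 * (1 / (k : ℝ) ^ 2) := by gcongr; exact h1.trans (h2.trans h3)
      _ = 108 * (k : ℝ) := by field_simp
  calc ∑ i : Fin 4, ∑ u ∈ (sbox (d := 4) M).erase 0, ∑ k ∈ Finset.Icc 1 M, (if u ∈ A i k then 1 / (k : ℝ) ^ 2 else 0)
      = ∑ i : Fin 4, ∑ k ∈ Finset.Icc 1 M, ∑ u ∈ (sbox (d := 4) M).erase 0, (if u ∈ A i k then 1 / (k : ℝ) ^ 2 else 0) := by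
        refine Finset.sum_congr rfl fun i _ => Finset.sum_comm
    _ ≤ ∑ _i : Fin 4, ∑ k ∈ Finset.Icc 1 M, (108 : ℝ) * (k : ℝ) :=
        Finset.sum_le_sum fun i _ => Finset.sum_le_sum fun k hk => hcard i k (Finset.mem_Icc.1 hk).1
    _ ≤ ∑ _i : Fin 4, (108 : ℝ) * (M : ℝ) ^ 2 := by
        refine Finset.sum_le_sum fun i _ => ?_
        calc ∑ k ∈ Finset.Icc 1 M, (108 : ℝ) * (k : ℝ) ≤ ∑ _k ∈ Finset.Icc 1 M, (108 : ℝ) * (M : ℝ) :=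
              Finset.sum_le_sum fun k hk => by gcongr; exact_mod_cast (Finset.mem_Icc.1 hk).2
          _ = 108 * (M : ℝ) ^ 2 := by rw [Finset.sum_const, Nat.card_Icc, nsmul_eq_mul]; push_cast; ring
    _ = 432 * (M : ℝ) ^ 2 := by simp; ring

/-- **Green mass of a sup-box**: `Σ_{u ∈ sbox M} G(u) ≤ G(0) + 864·K₀·M²` on `ℤ⁴` (`G ≤ 2K₀/‖u‖²` off the origin). [folklore] -/
theorem exists_sum_sbox_latticeGreen_le : ∃ C : ℝ, 0 ≤ C ∧ ∀ M : ℕ, 1 ≤ M →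
    ∑ u ∈ sbox (d := 4) M, latticeGreen u ≤ C * (M : ℝ) ^ 2 := by
  classical
  obtain ⟨K₀, hK₀0, hK₀⟩ := exists_gHalf_le_inv_norm_sq
  refine ⟨latticeGreen (0 : Site 4) + 864 * K₀, add_nonneg (latticeGreen_nonneg 4 (by norm_num) (0 : Site 4)) (by positivity),
    fun M hM => ?_⟩
  have h0 : (0 : Site 4) ∈ sbox M := mem_sbox.2 fun k => by simp
  rw [← Finset.add_sum_erase _ _ h0]
  have hG : ∀ u ∈ (sbox (d := 4) M).erase 0, latticeGreen u ≤ 2 * K₀ * (1 / ‖u‖ ^ 2) := by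
    intro u hu
    have hu0 : u ≠ 0 := (Finset.mem_erase.1 hu).1
    have h := hK₀ u hu0
    unfold gHalf at h
    rw [abs_le] at h
    have : latticeGreen u / 2 ≤ K₀ / ‖u‖ ^ 2 := h.2
    calc latticeGreen u = 2 * (latticeGreen u / 2) := by ring
      _ ≤ 2 * (K₀ / ‖u‖ ^ 2) := by gcongr
      _ = 2 * K₀ * (1 / ‖u‖ ^ 2) := by ring
  have h1 : ∑ u ∈ (sbox (d := 4) M).erase 0, latticeGreen u ≤ 2 * K₀ * (432 * (M : ℝ) ^ 2) := by
    calc ∑ u ∈ (sbox (d := 4) M).erase 0, latticeGreen u ≤ ∑ u ∈ (sbox (d := 4) M).erase 0, 2 * K₀ * (1 / ‖u‖ ^ 2) :=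
          Finset.sum_le_sum hG
      _ = 2 * K₀ * ∑ u ∈ (sbox (d := 4) M).erase 0, 1 / ‖u‖ ^ 2 := by rw [Finset.mul_sum]
      _ ≤ 2 * K₀ * (432 * (M : ℝ) ^ 2) := by gcongr; exact sum_sbox_inv_norm_sq_le M
  have hM1 : (1 : ℝ) ≤ (M : ℝ) ^ 2 := one_le_pow₀ (by exact_mod_cast hM)
  have hG0 := latticeGreen_nonneg 4 (by norm_num) (0 : Site 4)
  nlinarith

/-! ## §2 Cauchy–Schwarz and the covariance of the centre gradient with a far box of the exterior field -/

/-- Cauchy–Schwarz for square-integrable real functions: `(∫ f g)² ≤ (∫ f²)(∫ g²)` (discriminant of `t ↦ ∫ (f − t g)² ≥ 0`). [folklore] -/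
theorem sq_integral_mul_le_of_memLp {Ω : Type*} [MeasurableSpace Ω] (μ : Measure Ω) {f g : Ω → ℝ}
    (hf : MemLp f 2 μ) (hg : MemLp g 2 μ) :
    (∫ ω, f ω * g ω ∂μ) ^ 2 ≤ (∫ ω, (f ω) ^ 2 ∂μ) * ∫ ω, (g ω) ^ 2 ∂μ := by
  set A := ∫ ω, (f ω) ^ 2 ∂μ with hA
  set B := ∫ ω, f ω * g ω ∂μ with hB
  set V := ∫ ω, (g ω) ^ 2 ∂μ with hV
  have hfg : Integrable (fun ω => f ω * g ω) μ := hf.integrable_mul hg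
  have hquad : ∀ t : ℝ, 0 ≤ A - 2 * t * B + t ^ 2 * V := by
    intro t
    have hexp : ∀ ω, (f ω - t * g ω) ^ 2 = (f ω) ^ 2 - 2 * t * (f ω * g ω) + t ^ 2 * (g ω) ^ 2 := fun ω => by ring
    have h0 : 0 ≤ ∫ ω, (f ω - t * g ω) ^ 2 ∂μ := integral_nonneg fun ω => sq_nonneg _
    simp_rw [hexp] at h0
    have i1 : Integrable (fun ω => (f ω) ^ 2) μ := hf.integrable_sq
    have i2 : Integrable (fun ω => 2 * t * (f ω * g ω)) μ := hfg.const_mul _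
    have i3 : Integrable (fun ω => t ^ 2 * (g ω) ^ 2) μ := hg.integrable_sq.const_mul _
    have i12 : Integrable (fun ω => (f ω) ^ 2 - 2 * t * (f ω * g ω)) μ := i1.sub i2
    rw [integral_add i12 i3, integral_sub i1 i2, integral_const_mul, integral_const_mul] at h0
    simpa [hA, hB, hV] using h0
  have hV0 : 0 ≤ V := integral_nonneg fun ω => sq_nonneg _
  rcases hV0.eq_or_lt with hV0 | hVpos
  · -- V = 0 forces B = 0
    have hB0 : B = 0 := by
      by_contra hB0
      have h1 := hquad ((A + 1) / (2 * B))
      rw [← hV0, mul_zero, add_zero] at h1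
      have : 2 * ((A + 1) / (2 * B)) * B = A + 1 := by field_simp
      linarith
    rw [hB0, ← hV0]; simp
  · have h1 := hquad (B / V)
    have : A - 2 * (B / V) * B + (B / V) ^ 2 * V = A - B ^ 2 / V := by field_simp; ring
    rw [this, sub_nonneg, div_le_iff₀ hVpos] at h1
    linarith

variable {ν : Measure (Site 4 → ℝ)}

/-- **Covariance of the harmonic-extension gradient with an exterior site**: for `w ∉ Λ`, `x, x+e_j ∈ Λ`,
`∫ ∇_j(φ − ψ^Λ)(x)·φ_w dν = ½(G(x+e_j−w) − G(x−w))` — the Dirichlet part drops out (`E[ψ^Λ_a φ_w] = G_Λ(a,w) = 0`). [folklore] -/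
theorem integral_centreGradient_mul_coord (hν : IsDiscreteGFF ν (coordProc 4)) (Λ : Finset (Site 4)) {w : Site 4} (hw : w ∉ Λ)
    (x : Site 4) (j : Fin 4) :
    ∫ φ, ((φ (x + e j) - dirichletField Λ φ (x + e j)) - (φ x - dirichletField Λ φ x)) * φ w ∂ν =
      (latticeGreen (x + e j - w) - latticeGreen (x - w)) / 2 := by
  have hint : ∀ a : Site 4, Integrable (fun φ : Site 4 → ℝ => dirichletField Λ φ a * φ w) ν := fun a =>
    ((hν.isGaussianProcess_dirichletField Λ).hasGaussianLaw_eval a).memLp_two.integrable_mul (hν.memLp_coord w)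
  have hexp : ∀ φ : Site 4 → ℝ, ((φ (x + e j) - dirichletField Λ φ (x + e j)) - (φ x - dirichletField Λ φ x)) * φ w =
      (φ (x + e j) * φ w - dirichletField Λ φ (x + e j) * φ w) - (φ x * φ w - dirichletField Λ φ x * φ w) := fun φ => by ring
  simp_rw [hexp]
  have i1 : Integrable (fun φ : Site 4 → ℝ => φ (x + e j) * φ w) ν := hν.integrable_coord_mul _ _
  have i2 : Integrable (fun φ : Site 4 → ℝ => dirichletField Λ φ (x + e j) * φ w) ν := hint _
  have i3 : Integrable (fun φ : Site 4 → ℝ => φ x * φ w) ν := hν.integrable_coord_mul _ _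
  have i4 : Integrable (fun φ : Site 4 → ℝ => dirichletField Λ φ x * φ w) ν := hint _
  have i12 : Integrable (fun φ : Site 4 → ℝ => φ (x + e j) * φ w - dirichletField Λ φ (x + e j) * φ w) ν := i1.sub i2
  have i34 : Integrable (fun φ : Site 4 → ℝ => φ x * φ w - dirichletField Λ φ x * φ w) ν := i3.sub i4
  rw [integral_sub i12 i34, integral_sub i1 i2, integral_sub i3 i4,
    hν.integral_dirichletField_mul_coord (by norm_num) Λ _ w, hν.integral_dirichletField_mul_coord (by norm_num) Λ _ w,
    dirichletGreen_of_not_mem_right Λ _ hw, dirichletGreen_of_not_mem_right Λ _ hw]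
  have h1 : ∫ φ : Site 4 → ℝ, φ (x + e j) * φ w ∂ν = latticeGreen (x + e j - w) / 2 := hν.2.2 (x + e j) w
  have h2 : ∫ φ : Site 4 → ℝ, φ x * φ w ∂ν = latticeGreen (x - w) / 2 := hν.2.2 x w
  rw [h1, h2]
  ring

/-- **The main term**: `G(z − e_j) − G(z) ≥ a₄/(256 N³)` for `z` in the far corner box `[N, 2N]⁴` and `N ≥ N₀` (`a₄ = Γ(1)/(2π²)`), from the tree's
Lawler gradient asymptotics `G(z − e_j) − G(z) = 2a₄ z_j |z|⁻⁴ + O(|z|⁻⁴)`. [cite: Lawler1991, Theorem 1.5.5 (1.36)] -/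
theorem exists_latticeGreen_backDiff_ge : ∃ a : ℝ, 0 < a ∧ ∃ N₀ : ℕ, ∀ N : ℕ, N₀ ≤ N → 1 ≤ N → ∀ (j : Fin 4) (z : Site 4),
    (∀ k, (N : ℤ) ≤ z k ∧ z k ≤ 2 * N) → a / (N : ℝ) ^ 3 ≤ latticeGreen (z - Pi.single j 1) - latticeGreen z := by
  obtain ⟨K₂, hK₂0, hK₂⟩ := latticeGreen_gradient_asymptotics (d := 4) (by norm_num)
  set a : ℝ := Real.Gamma (((4 : ℕ) : ℝ) / 2 - 1) / (2 * Real.pi ^ (((4 : ℕ) : ℝ) / 2)) with ha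
  have ha0 : 0 < a := by
    rw [ha]
    refine div_pos (Real.Gamma_pos_of_pos (by norm_num)) (by positivity)
  refine ⟨a / 256, by positivity, ⌈K₂ / a⌉₊, fun N hN hN1 j z hz => ?_⟩
  have hNpos : (0 : ℝ) < N := by exact_mod_cast hN1
  have hNK : K₂ ≤ a * N := by
    have h1 : K₂ / a ≤ N := (Nat.le_ceil _).trans (by exact_mod_cast hN)
    rwa [div_le_iff₀ ha0, mul_comm] at h1
  have hzj : (N : ℝ) ≤ ((z j : ℤ) : ℝ) := by exact_mod_cast (hz j).1
  have hz0 : z ≠ 0 := by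
    intro h
    have := (hz j).1
    rw [h] at this
    simp at this
    omega
  set S : ℝ := ∑ k, ((z k : ℤ) : ℝ) ^ 2 with hS
  have hS1 : 1 ≤ S := one_le_sum_sq_of_ne_zero hz0
  have hSpos : 0 < S := by linarith
  have hSle : S ≤ 16 * (N : ℝ) ^ 2 := by
    have hk : ∀ k, ((z k : ℤ) : ℝ) ^ 2 ≤ (2 * (N : ℝ)) ^ 2 := fun k => by
      have h1 : ((N : ℤ) : ℝ) ≤ ((z k : ℤ) : ℝ) := by exact_mod_cast (hz k).1
      have h2 : ((z k : ℤ) : ℝ) ≤ 2 * (N : ℝ) := by exact_mod_cast (hz k).2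
      push_cast at h1
      nlinarith
    calc S = ∑ k : Fin 4, ((z k : ℤ) : ℝ) ^ 2 := rfl
      _ ≤ ∑ _k : Fin 4, (2 * (N : ℝ)) ^ 2 := Finset.sum_le_sum fun k _ => hk k
      _ = 16 * (N : ℝ) ^ 2 := by simp; ring
  -- `ρ^{-4} = 1/S²`
  have hρ : Real.sqrt S ^ (-((4 : ℕ) : ℝ)) = 1 / S ^ 2 := by
    rw [Real.rpow_neg (Real.sqrt_nonneg _), Real.rpow_natCast, one_div]
    congr 1
    rw [show (4 : ℕ) = 2 * 2 from rfl, pow_mul, Real.sq_sqrt hSpos.le]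
  have h := (hK₂ z hz0 j).2
  rw [hρ] at h
  rw [abs_le] at h
  have hmain : latticeGreen (z - Pi.single j 1) - latticeGreen z ≥ (2 * a * ((z j : ℤ) : ℝ) - K₂) * (1 / S ^ 2) := by
    have h1 := h.1
    have e1 : a * ((2 - ((4 : ℕ) : ℝ)) * ((z j : ℤ) : ℝ) * (1 / S ^ 2)) = -(2 * a * ((z j : ℤ) : ℝ) * (1 / S ^ 2)) := by
      push_cast; ring
    rw [e1] at h1
    nlinarith
  have hcoef : a * N ≤ 2 * a * ((z j : ℤ) : ℝ) - K₂ := by nlinarith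
  have hS2 : 1 / S ^ 2 ≥ 1 / (256 * (N : ℝ) ^ 4) := by
    rw [ge_iff_le, one_div_le_one_div (by positivity) (by positivity)]
    nlinarith [hSle, hSpos]
  calc a / 256 / (N : ℝ) ^ 3 = a * N * (1 / (256 * (N : ℝ) ^ 4)) := by field_simp
    _ ≤ (2 * a * ((z j : ℤ) : ℝ) - K₂) * (1 / S ^ 2) := by
        gcongr
        · nlinarith
    _ ≤ latticeGreen (z - Pi.single j 1) - latticeGreen z := hmain

/-! ## §3 The lower `R⁻⁴` law -/

/-- **The free-field response is of order EXACTLY `R⁻⁴` (lower bound).**  For the lattice GFF `ν` of `ℤ⁴` there are absolute `c > 0` and `R₀`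
such that for every `R ≥ R₀` (`R ≥ 1`), every direction `j` and centre `x`:
`c/R⁴ ≤ ∫ (∇_j(φ − ψ^Λ)(x))² dν`, `Λ = x + sbox(R+1)` —
together with `…Law.gff_integral_centreGradient_sq_le` (`≤ v/R⁴`) the squared centre gradient of the harmonic extension of the exterior field has
mean `≍ R⁻⁴`: the weight `R⁴` of the registered (RM) currency is critical in the free field (no faster rate is Gaussian-consistent).
Proof: Cauchy–Schwarz against `Y = Σ_{z ∈ [N,2N]⁴} φ_{x+z}`, `N = R+2`: `Cov(∇_j h(x), Y) ≥ a N/2` (Lawler's gradient asymptotics, the Dirichlet part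
being orthogonal to the exterior), `Var Y ≤ 128(C_G+1)N⁶` (Green decay summed over sup-shells). [cite: Lawler1991, Theorem 1.5.5 (1.36)] -/
theorem gff_integral_centreGradient_sq_ge (hν : IsDiscreteGFF ν (coordProc 4)) :
    ∃ c : ℝ, 0 < c ∧ ∃ R₀ : ℕ, ∀ (R : ℕ), R₀ ≤ R → 1 ≤ R → ∀ (j : Fin 4) (x : Site 4),
      c / (R : ℝ) ^ 4 ≤ ∫ φ, ((φ (x + e j) - dirichletField ((sbox (R + 1)).image (fun z => x + z)) φ (x + e j)) -
           (φ x - dirichletField ((sbox (R + 1)).image (fun z => x + z)) φ x)) ^ 2 ∂ν := by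
  classical
  obtain ⟨a, ha0, N₀, hmain⟩ := exists_latticeGreen_backDiff_ge
  obtain ⟨CG, hCG0, hCG⟩ := exists_sum_sbox_latticeGreen_le
  refine ⟨a ^ 2 / (512 * 81 * (CG + 1)), by positivity, N₀, fun R hR0 hR j x => ?_⟩
  have hP := hν.1.isProbabilityMeasure
  set N : ℕ := R + 2 with hN
  have hN1 : 1 ≤ N := by omega
  have hNN₀ : N₀ ≤ N := by omega
  have hNpos : (0 : ℝ) < N := by exact_mod_cast hN1
  set Λ : Finset (Site 4) := (sbox (R + 1)).image (fun z => x + z) with hΛ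
  set P : Finset (Site 4) := Fintype.piFinset (fun _ : Fin 4 => Finset.Icc (N : ℤ) (2 * N)) with hPdef
  have hPmem : ∀ z ∈ P, ∀ k, (N : ℤ) ≤ z k ∧ z k ≤ 2 * N := fun z hz k =>
    Finset.mem_Icc.1 (Fintype.mem_piFinset.1 hz k)
  have hPcard : #P = (N + 1) ^ 4 := by
    rw [hPdef, Fintype.card_piFinset, Finset.prod_const, Finset.card_univ, Fintype.card_fin, Int.card_Icc]
    have : ((2 : ℤ) * N + 1 - N).toNat = N + 1 := by omega
    rw [this]
  have hPΛ : ∀ z ∈ P, x + z ∉ Λ := by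
    intro z hz hmem
    have h := (mem_image_sbox_iff x (x + z)).1 hmem j
    have h2 := (hPmem z hz j).1
    simp only [Pi.add_apply, add_sub_cancel_left] at h
    rw [abs_le] at h
    push_cast at h
    omega
  set C : Finset (Site 4) := P.image (fun z => x + z) with hC
  -- the gradient of the harmonic extension and the far-box statistic
  set g : (Site 4 → ℝ) → ℝ := fun φ => (φ (x + e j) - dirichletField Λ φ (x + e j)) - (φ x - dirichletField Λ φ x) with hg
  set Y : (Site 4 → ℝ) → ℝ := fun φ => ∑ w ∈ C, (fun _ : Site 4 => (1 : ℝ)) w * φ w with hY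
  have hψ2 : ∀ y : Site 4, MemLp (fun φ : Site 4 → ℝ => dirichletField Λ φ y) 2 ν := fun y =>
    ((hν.isGaussianProcess_dirichletField Λ).hasGaussianLaw_eval y).memLp_two
  have hgL2 : MemLp g 2 ν := by
    simp only [hg]
    exact ((hν.memLp_coord _).sub (hψ2 _)).sub ((hν.memLp_coord _).sub (hψ2 _))
  have hYL2 : MemLp Y 2 ν := memLp_two_linStat hν C (fun _ => 1)
  -- (1) covariance lower bound
  have hcov : a * N / 2 ≤ ∫ φ, g φ * Y φ ∂ν := by
    have hexp : ∀ φ, g φ * Y φ = ∑ w ∈ C, g φ * φ w := by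
      intro φ; simp only [hY, one_mul, Finset.mul_sum]
    simp_rw [hexp]
    have hI : ∀ w : Site 4, Integrable (fun φ : Site 4 → ℝ => g φ * φ w) ν := fun w => hgL2.integrable_mul (hν.memLp_coord w)
    rw [integral_finsetSum _ fun w _ => hI w, hC, Finset.sum_image fun a _ b _ h => add_left_cancel h]
    have hterm : ∀ z ∈ P, a / (N : ℝ) ^ 3 / 2 ≤ ∫ φ, g φ * φ (x + z) ∂ν := by
      intro z hz
      simp only [hg]
      rw [integral_centreGradient_mul_coord hν Λ (hPΛ z hz) x j]
      have e1 : x + e j - (x + z) = -(z - Pi.single j 1) := by rw [e_def]; abel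
      have e2 : x - (x + z) = -z := by abel
      rw [e1, e2, latticeGreen_neg, latticeGreen_neg]
      have := hmain N hNN₀ hN1 j z (hPmem z hz)
      linarith
    have hN4 : (N : ℝ) ^ 4 ≤ #P := by
      rw [hPcard]; push_cast
      exact pow_le_pow_left₀ hNpos.le (by linarith) 4
    calc a * N / 2 = (N : ℝ) ^ 4 * (a / (N : ℝ) ^ 3 / 2) := by field_simp
      _ ≤ #P * (a / (N : ℝ) ^ 3 / 2) := by gcongr
      _ = ∑ _z ∈ P, a / (N : ℝ) ^ 3 / 2 := by rw [Finset.sum_const, nsmul_eq_mul]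
      _ ≤ ∑ z ∈ P, ∫ φ, g φ * φ (x + z) ∂ν := Finset.sum_le_sum hterm
  -- (2) variance upper bound
  have hvar : ∫ φ, (Y φ) ^ 2 ∂ν ≤ 128 * (CG + 1) * (N : ℝ) ^ 6 := by
    simp only [hY]
    rw [integral_linStat_sq hν C (fun _ => 1), greenEnergy]
    simp only [one_mul]
    have hrow : ∀ w ∈ C, ∑ w' ∈ C, latticeGreen (w - w') ≤ CG * ((4 * N : ℕ) : ℝ) ^ 2 := by
      intro w hw
      rw [← Finset.sum_image (f := latticeGreen) fun a _ b _ h => sub_right_injective h]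
      refine (Finset.sum_le_sum_of_subset_of_nonneg ?_ fun u _ _ => latticeGreen_nonneg 4 (by norm_num) u).trans
        (hCG (4 * N) (by omega))
      intro u hu
      obtain ⟨w', hw', rfl⟩ := Finset.mem_image.1 hu
      obtain ⟨z, hz, rfl⟩ := Finset.mem_image.1 hw
      obtain ⟨z', hz', rfl⟩ := Finset.mem_image.1 hw'
      rw [mem_sbox]
      intro k
      have h1 := hPmem z hz k
      have h2 := hPmem z' hz' k
      simp only [Pi.sub_apply, Pi.add_apply, add_sub_add_left_eq_sub]
      rw [abs_le]; push_cast; omega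
    have hCcard : (#C : ℝ) ≤ 16 * (N : ℝ) ^ 4 := by
      have h1 : #C ≤ (N + 1) ^ 4 := hPcard ▸ Finset.card_image_le
      have hN1' : (1 : ℝ) ≤ N := by exact_mod_cast hN1
      have h2 : ((N : ℝ) + 1) ^ 4 ≤ (2 * (N : ℝ)) ^ 4 := pow_le_pow_left₀ (by positivity) (by linarith) 4
      calc (#C : ℝ) ≤ (((N + 1) ^ 4 : ℕ) : ℝ) := by exact_mod_cast h1
        _ = ((N : ℝ) + 1) ^ 4 := by push_cast; ring
        _ ≤ 16 * (N : ℝ) ^ 4 := by nlinarith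
    calc (∑ w ∈ C, ∑ w' ∈ C, latticeGreen (w - w')) / 2 ≤ (∑ _w ∈ C, CG * ((4 * N : ℕ) : ℝ) ^ 2) / 2 := by
          gcongr with w hw
          exact hrow w hw
      _ = #C * (CG * (16 * (N : ℝ) ^ 2)) / 2 := by rw [Finset.sum_const, nsmul_eq_mul]; push_cast; ring
      _ ≤ 16 * (N : ℝ) ^ 4 * ((CG + 1) * (16 * (N : ℝ) ^ 2)) / 2 := by gcongr; linarith
      _ = 128 * (CG + 1) * (N : ℝ) ^ 6 := by ring
  -- (3) Cauchy–Schwarz and assembly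
  have hCS := sq_integral_mul_le_of_memLp ν hgL2 hYL2
  have hA0 : 0 ≤ ∫ φ, (g φ) ^ 2 ∂ν := integral_nonneg fun _ => sq_nonneg _
  have hA : (a * N / 2) ^ 2 / (128 * (CG + 1) * (N : ℝ) ^ 6) ≤ ∫ φ, (g φ) ^ 2 ∂ν := by
    rw [div_le_iff₀ (by positivity)]
    calc (a * N / 2) ^ 2 ≤ (∫ φ, g φ * Y φ ∂ν) ^ 2 := pow_le_pow_left₀ (by positivity) hcov 2
      _ ≤ (∫ φ, (g φ) ^ 2 ∂ν) * ∫ φ, (Y φ) ^ 2 ∂ν := hCS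
      _ ≤ (∫ φ, (g φ) ^ 2 ∂ν) * (128 * (CG + 1) * (N : ℝ) ^ 6) := by gcongr
  have hNR : (N : ℝ) ≤ 3 * R := by
    have : N ≤ 3 * R := by omega
    exact_mod_cast this
  have hRpos : (0 : ℝ) < R := by exact_mod_cast hR
  show a ^ 2 / (512 * 81 * (CG + 1)) / (R : ℝ) ^ 4 ≤ ∫ φ, (g φ) ^ 2 ∂ν
  refine le_trans ?_ hA
  rw [div_le_div_iff₀ (by positivity) (by positivity)]
  have h4 : (N : ℝ) ^ 4 ≤ (3 * (R : ℝ)) ^ 4 := pow_le_pow_left₀ hNpos.le hNR 4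
  have e1 : (a * N / 2) ^ 2 * (R : ℝ) ^ 4 = a ^ 2 / 4 * ((N : ℝ) ^ 2 * (R : ℝ) ^ 4) := by ring
  have e2 : a ^ 2 / (512 * 81 * (CG + 1)) * (128 * (CG + 1) * (N : ℝ) ^ 6) = a ^ 2 / 4 * ((N : ℝ) ^ 6 / 81) := by
    field_simp; ring
  rw [e1, e2]
  gcongr
  calc (N : ℝ) ^ 6 / 81 = (N : ℝ) ^ 2 * ((N : ℝ) ^ 4 / 81) := by ring
    _ ≤ (N : ℝ) ^ 2 * (R : ℝ) ^ 4 := by gcongr; linarith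

end Summit.QuantumFields.YangMills.Cruxes.UVSeamRec.GaussianCalibration

end
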